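import Summits.Ventures.PercRepro.Night2LineHitNine
import Summits.Ventures.PercRepro.Night2NonFatLineCell

/-!
# night-2: THE LINE CELLS OF THE HITTING PROGRAMME — nine collinear points, and the small cells (gen 39)

For a line `ℓ = cl {x, y}` (`x ≠ y ∈ G ∖ K`) with `d = |W ∩ ℓ|` and `k = |W ∖ ℓ|`:
* `k ≤ 1` is impossible (`rk W ≥ 4`);
* `k = 2`: with at most one basis point on `ℓ` the targets `Q ∪ (Y_D ∪ O)`, `|Y_D| = 4`, are unloaded (the four-point
  lemma), of capacity `1` (`rk (G ∖ T) ≤ 2`) and face sum `≤ lineFaceBound (4 + q) (7 − q) / 3`, so `d ≥ 9` suffices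
  (`C(9, 4) · 3 / 301 = 1.26`, `C(9, 4) · 3 / 265 = 1.43`: `basis_pair_fair_of_line_two_off`); with two basis points on `ℓ`
  it is gen 37's line + 2 theorem (`basis_pair_fair_of_line_two_off_basis`);
* `k ≥ 3`: the hitting line theorem with `lineHitIncome q 9 k ≥ 1` for `k ≤ 28` (Night2LineHitNine).
**`basis_pair_fair_of_nine_collinear`**: a lossy basis pair of the non-fat cell whose `W` has nine collinear points and at
most `28` points off that line is fair.  **`basis_pair_fair_of_line_cells`**: the cells `(d, k) = (6, 6), (7, 6), (7, 5),
(8, 6), (8, 5), (8, 4)` (every `q ≤ 2`).  Paper: proofs/NIGHT-2-g39.md §4.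
-/

namespace PercRepro.Shadow

open PercRepro.ThmH PercRepro.PerFlat

variable {α : Type*} [DecidableEq α] {M : Matroid α} [M.Finite] {G : Finset α}

/-- **The small line cells**: `lineHitIncome q d k ≥ 1` for `(d, k) = (6, 6), (7, 6), (7, 5), (8, 6), (8, 5), (8, 4)` and
every `q ≤ 2`. -/
theorem one_le_lineHitIncome_small {q d k : ℕ} (hq : q ≤ 2)
    (hdk : (d = 6 ∧ k = 6) ∨ (d = 7 ∧ k = 6) ∨ (d = 7 ∧ k = 5) ∨ (d = 8 ∧ k = 6) ∨ (d = 8 ∧ k = 5) ∨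
      (d = 8 ∧ k = 4)) :
    1 ≤ lineHitIncome q d k := by
  rcases hdk with ⟨rfl, rfl⟩ | ⟨rfl, rfl⟩ | ⟨rfl, rfl⟩ | ⟨rfl, rfl⟩ | ⟨rfl, rfl⟩ | ⟨rfl, rfl⟩ <;>
    interval_cases q <;>
    (unfold lineHitIncome hitInner
     simp only [Finset.sum_range_succ, Finset.sum_range_zero]
     norm_num [lineFaceBound, Nat.choose, max_def])

/-- **Two points off a line with at most one basis point and `≥ 9` points of `W` ⇒ fair** (the targets `Q ∪ (Y_D ∪ O)`
with `|Y_D| = 4`: unloaded, `vCap = 1`, face sum `≤ lineFaceBound (4 + q) (7 − q) / 3`). -/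
theorem basis_pair_fair_of_line_two_off (hG : G ∈ flatsQ M (5 + 1)) (hd : (gr M \ G).card = 2)
    (hk : kColoops M G = 1) (hs : ∀ e ∈ gr M, ∀ f ∈ gr M, e ≠ f → rkN M {e, f} = 2)
    (hl : ∀ e ∈ gr M, M.Indep {e}) (hnf : fatClosures M 5 G 2 = ∅) {B : Finset α}
    (hB : B ∈ thinMembers M 5 G) (hnP : ¬ bigP M G B) {z : α} (hz : z ∈ G \ clF M B)
    (hl0 : loss M 5 G B z ≠ 0) {x y : α}
    (hq : ((insert z B \ coloops M G) ∩ clF M {x, y}).card ≤ 1)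
    (hd9 : 9 ≤ ((G \ insert z B) ∩ clF M {x, y}).card)
    (hk2 : ((G \ insert z B) \ clF M {x, y}).card = 2) :
    loss M 5 G B z ≤ rhoL M 5 G B z * lossIncomeH M 5 G (bigP M G) (dshGT2 M 5 G) B z := by
  have hfat : (fatClosures M 5 G 2).card ≤ 1 := by
    rw [hnf, Finset.card_empty]
    exact zero_le_one
  have hQG : insert z B ⊆ G :=
    Finset.insert_subset (Finset.mem_sdiff.1 hz).1 (subset_G_of_mem_thinMembers hB)
  obtain ⟨-, hQ'5⟩ := rkN_insert_sdiff_coloops_eq_five hG hd hk hB hnP hz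
  set D : Finset α := (G \ insert z B) ∩ clF M {x, y} with hDdef
  set O : Finset α := (G \ insert z B) \ clF M {x, y} with hOdef
  set 𝒯 : Finset (Finset α) := (D.powersetCard 4).image (fun YD => insert z B ∪ (YD ∪ O)) with h𝒯
  have hDW : D ⊆ G \ insert z B := Finset.inter_subset_left
  have hOW : O ⊆ G \ insert z B := Finset.sdiff_subset
  have hmemD : ∀ YD ∈ D.powersetCard 4, YD ⊆ D ∧ YD.card = 4 := fun YD hYD => Finset.mem_powersetCard.1 hYD
  have h𝒯sub : 𝒯 ⊆ tgtSets M 5 G B z := by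
    intro T hT
    rw [h𝒯, Finset.mem_image] at hT
    obtain ⟨YD, hYD, rfl⟩ := hT
    obtain ⟨hYDD, hYD4⟩ := hmemD YD hYD
    rw [tgtSets_eq_image hG (mem_thinMembers.1 hB).1 hz, Finset.mem_image]
    refine ⟨YD ∪ O, Finset.mem_filter.2 ⟨Finset.mem_powerset.2 (Finset.union_subset (hYDD.trans hDW) hOW), ?_⟩, rfl⟩
    exact Finset.Nonempty.mono Finset.subset_union_left (Finset.card_pos.1 (by omega))
  have hinj : Set.InjOn (fun YD => insert z B ∪ (YD ∪ O)) ((D.powersetCard 4 : Finset _) : Set _) := by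
    intro Y₁ hY₁ Y₂ hY₂ heq
    rw [Finset.mem_coe] at hY₁ hY₂
    have key : ∀ YD ∈ D.powersetCard 4, (insert z B ∪ (YD ∪ O)) ∩ D = YD := by
      intro YD hYD
      ext e
      rw [Finset.mem_inter, Finset.mem_union, Finset.mem_union]
      constructor
      · rintro ⟨he | he | he, heD⟩
        · exact absurd he (Finset.mem_sdiff.1 (hDW heD)).2
        · exact he
        · exact absurd (Finset.mem_inter.1 heD).2 (Finset.mem_sdiff.1 he).2
      · intro he
        exact ⟨Or.inr (Or.inl he), (hmemD YD hYD).1 he⟩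
    have h1 := key Y₁ hY₁
    have h2 := key Y₂ hY₂
    simp only at heq
    rw [← h1, ← h2, heq]
  -- the per-target bound
  have hterm : ∀ YD ∈ D.powersetCard 4, 3 / ((lineFaceBound (4 + ((insert z B \ coloops M G) ∩ clF M {x, y}).card)
      (7 - ((insert z B \ coloops M G) ∩ clF M {x, y}).card) : ℕ) : ℚ) ≤
      vCap M G (insert z B ∪ (YD ∪ O)) / faceSum M G (insert z B ∪ (YD ∪ O)) := by
    intro YD hYD
    obtain ⟨hYDD, hYD4⟩ := hmemD YD hYD
    have hYW : YD ∪ O ⊆ G \ insert z B := Finset.union_subset (hYDD.trans hDW) hOW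
    have hT : insert z B ∪ (YD ∪ O) ∈ tgtSets M 5 G B z := h𝒯sub (Finset.mem_image.2 ⟨YD, hYD, rfl⟩)
    have hTG : insert z B ∪ (YD ∪ O) ⊆ G := Finset.union_subset hQG (hYW.trans Finset.sdiff_subset)
    have hdl : dload M 5 G (bigP M G) (dshGT2 M 5 G) (insert z B ∪ (YD ∪ O)) = 0 :=
      dload_eq_zero_of_line_target_four hG hd hk hs hl hfat hB hnP hz {x, y} hYDD (by omega)
        (Finset.Subset.refl _) (by omega)
    have hcomp : G \ (insert z B ∪ (YD ∪ O)) ⊆ clF M {x, y} := by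
      intro e he
      simp only [Finset.mem_sdiff, Finset.mem_union, not_or] at he
      obtain ⟨heG, heQ, -, heO⟩ := he
      by_contra hel
      exact heO (Finset.mem_sdiff.2 ⟨Finset.mem_sdiff.2 ⟨heG, heQ⟩, hel⟩)
    have hrk3 : rkN M (G \ (insert z B ∪ (YD ∪ O))) ≤ 3 := by
      refine le_trans (rkN_le_of_subset_clF' hcomp) ?_
      exact le_trans (rkN_le_card _) (le_trans Finset.card_le_two (by norm_num))
    have hv : vCap M G (insert z B ∪ (YD ∪ O)) = 1 := vCap_eq_one_of_rkN_sdiff_le_three hd hdl hrk3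
    have hpos := faceSum_pos_of_mem_tgtSets hG hd hk hB hnP hz hl0 hT
    have hfs := faceSum_le_third_mul_lineCount hG hd hk hnf hTG x y
    have hT'K := union_sdiff_coloops_eq_of_subset hG hd hB (z := z) hYW
    have hcard_in : (((insert z B ∪ (YD ∪ O)) \ coloops M G) ∩ clF M {x, y}).card ≤
        4 + ((insert z B \ coloops M G) ∩ clF M {x, y}).card := by
      rw [hT'K, Finset.union_inter_distrib_right, Finset.union_inter_distrib_right]
      have hOl : O ∩ clF M {x, y} = ∅ := by
        rw [Finset.eq_empty_iff_forall_notMem]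
        intro e he
        exact (Finset.mem_sdiff.1 (Finset.mem_inter.1 he).1).2 (Finset.mem_inter.1 he).2
      rw [hOl, Finset.union_empty]
      refine le_trans (Finset.card_union_le _ _) ?_
      have := Finset.card_le_card (Finset.inter_subset_left : YD ∩ clF M {x, y} ⊆ YD)
      omega
    have hcard_off : (((insert z B ∪ (YD ∪ O)) \ coloops M G) \ clF M {x, y}).card ≤
        7 - ((insert z B \ coloops M G) ∩ clF M {x, y}).card := by
      rw [hT'K, Finset.union_sdiff_distrib, Finset.union_sdiff_distrib]
      have hYDl : YD \ clF M {x, y} = ∅ := by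
        rw [Finset.eq_empty_iff_forall_notMem]
        intro e he
        exact (Finset.mem_sdiff.1 he).2 (Finset.mem_inter.1 (hYDD (Finset.mem_sdiff.1 he).1)).2
      rw [hYDl, Finset.empty_union]
      have hQ'off := Finset.card_sdiff_add_card_inter (insert z B \ coloops M G) (clF M {x, y})
      refine le_trans (Finset.card_union_le _ _) ?_
      have := Finset.card_le_card (Finset.sdiff_subset : O \ clF M {x, y} ⊆ O)
      omega
    have hfs' : faceSum M G (insert z B ∪ (YD ∪ O)) ≤ 1 / 3 * ((lineFaceBound
        (4 + ((insert z B \ coloops M G) ∩ clF M {x, y}).card)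
        (7 - ((insert z B \ coloops M G) ∩ clF M {x, y}).card) : ℕ) : ℚ) := by
      refine le_trans hfs ?_
      apply mul_le_mul_of_nonneg_left _ (by norm_num)
      exact_mod_cast lineFaceBound_mono hcard_in hcard_off
    have hLpos : (0 : ℚ) < ((lineFaceBound (4 + ((insert z B \ coloops M G) ∩ clF M {x, y}).card)
        (7 - ((insert z B \ coloops M G) ∩ clF M {x, y}).card) : ℕ) : ℚ) := by
      exact_mod_cast lineFaceBound_pos (by omega)
    rw [hv, div_le_div_iff₀ hLpos hpos]
    linarith
  have hsum𝒯 : ∑ _YD ∈ D.powersetCard 4, 3 / ((lineFaceBound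
      (4 + ((insert z B \ coloops M G) ∩ clF M {x, y}).card)
      (7 - ((insert z B \ coloops M G) ∩ clF M {x, y}).card) : ℕ) : ℚ) ≤
      ∑ T ∈ 𝒯, vCap M G T / faceSum M G T := by
    rw [h𝒯, Finset.sum_image hinj]
    exact Finset.sum_le_sum hterm
  rw [Finset.sum_const, Finset.card_powersetCard, nsmul_eq_mul] at hsum𝒯
  apply basis_pair_fair_of_vCap_face_sum_subfamily hG hd hk hs hl hfat hB hnP hz hl0 h𝒯sub
  refine le_trans ?_ hsum𝒯
  have h126 : ((9 : ℕ).choose 4 : ℚ) ≤ ((D.card.choose 4 : ℕ) : ℚ) := by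
    exact_mod_cast Nat.choose_le_choose 4 hd9
  have hpos' : (0 : ℚ) ≤ 3 / ((lineFaceBound (4 + ((insert z B \ coloops M G) ∩ clF M {x, y}).card)
      (7 - ((insert z B \ coloops M G) ∩ clF M {x, y}).card) : ℕ) : ℚ) := by positivity
  refine le_trans ?_ (mul_le_mul_of_nonneg_right h126 hpos')
  rcases Nat.lt_or_ge ((insert z B \ coloops M G) ∩ clF M {x, y}).card 1 with h0 | h1
  · have h : ((insert z B \ coloops M G) ∩ clF M {x, y}).card = 0 := by omega
    rw [h]
    norm_num [lineFaceBound, Nat.choose]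
  · have h : ((insert z B \ coloops M G) ∩ clF M {x, y}).card = 1 := by omega
    rw [h]
    norm_num [lineFaceBound, Nat.choose]

/-- **Two points off a line through two basis points ⇒ fair** (gen 37's line + 2 theorem). -/
theorem basis_pair_fair_of_line_two_off_basis (hG : G ∈ flatsQ M (5 + 1)) (hd : (gr M \ G).card = 2)
    (hk : kColoops M G = 1) (hs : ∀ e ∈ gr M, ∀ f ∈ gr M, e ≠ f → rkN M {e, f} = 2)
    (hl : ∀ e ∈ gr M, M.Indep {e}) (hnf : fatClosures M 5 G 2 = ∅) {B : Finset α}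
    (hB : B ∈ thinMembers M 5 G) (hnP : ¬ bigP M G B) {z : α} (hz : z ∈ G \ clF M B)
    (hl0 : loss M 5 G B z ≠ 0) {x y : α}
    (hq : ((insert z B \ coloops M G) ∩ clF M {x, y}).card = 2)
    (hk2 : ((G \ insert z B) \ clF M {x, y}).card = 2) :
    loss M 5 G B z ≤ rhoL M 5 G B z * lossIncomeH M 5 G (bigP M G) (dshGT2 M 5 G) B z := by
  have hGg : G ⊆ gr M := (mem_flatsQ.1 hG).1
  have hQG : insert z B ⊆ G :=
    Finset.insert_subset (Finset.mem_sdiff.1 hz).1 (subset_G_of_mem_thinMembers hB)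
  obtain ⟨-, hQ'5⟩ := rkN_insert_sdiff_coloops_eq_five hG hd hk hB hnP hz
  obtain ⟨a, b, hab, hQℓ⟩ := Finset.card_eq_two.1 hq
  obtain ⟨y₁, y₂, hne, hO⟩ := Finset.card_eq_two.1 hk2
  have hℓg : clF M {x, y} ⊆ gr M := fun e he => mem_gr_of_mem_clF he
  have hℓ2 : rkN M (clF M {x, y}) ≤ 2 := by
    refine le_trans (rkN_le_of_subset_clF' (Finset.Subset.refl _)) ?_
    exact le_trans (rkN_le_card _) Finset.card_le_two
  have haQ : a ∈ (insert z B \ coloops M G) ∩ clF M {x, y} := by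
    rw [hQℓ]
    exact Finset.mem_insert_self _ _
  have hbQ : b ∈ (insert z B \ coloops M G) ∩ clF M {x, y} := by
    rw [hQℓ]
    exact Finset.mem_insert_of_mem (Finset.mem_singleton_self _)
  have hy₁ : y₁ ∈ (G \ insert z B) \ clF M {x, y} := by
    rw [hO]
    exact Finset.mem_insert_self _ _
  have hy₂ : y₂ ∈ (G \ insert z B) \ clF M {x, y} := by
    rw [hO]
    exact Finset.mem_insert_of_mem (Finset.mem_singleton_self _)
  have hA3 : ((insert z B \ coloops M G) \ clF M {x, y}).card = 3 := by
    have := Finset.card_sdiff_add_card_inter (insert z B \ coloops M G) (clF M {x, y})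
    omega
  apply basis_pair_fair_of_line_plus_two hG hd hk hs hl hnf hB hnP hz hl0 Finset.sdiff_subset hA3 hne
    (Finset.mem_sdiff.1 hy₁).1 (Finset.mem_sdiff.1 hy₂).1
  intro w hwW hw1 hw2
  have hwℓ : w ∈ clF M {x, y} := by
    by_contra hnot
    have : w ∈ (G \ insert z B) \ clF M {x, y} := Finset.mem_sdiff.2 ⟨hwW, hnot⟩
    rw [hO, Finset.mem_insert, Finset.mem_singleton] at this
    rcases this with h | h
    · exact hw1 h
    · exact hw2 h
  have hmem : ∀ c ∈ (insert z B \ coloops M G) ∩ clF M {x, y},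
      c ∈ clF M (insert z B \ ((insert z B \ coloops M G) \ clF M {x, y})) := by
    intro c hc
    have hcQ : c ∈ insert z B \ ((insert z B \ coloops M G) \ clF M {x, y}) := by
      rw [Finset.mem_sdiff, Finset.mem_sdiff]
      exact ⟨(Finset.mem_sdiff.1 (Finset.mem_inter.1 hc).1).1, fun h => h.2 (Finset.mem_inter.1 hc).2⟩
    exact subset_clF_of_subset_gr (Finset.sdiff_subset.trans (hQG.trans hGg)) hcQ
  have hsub : clF M {x, y} ⊆ clF M (insert z B \ ((insert z B \ coloops M G) \ clF M {x, y})) :=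
    subset_clF_of_rkN_le_two_of_two_mem hs hℓg hℓ2 (Finset.mem_inter.1 haQ).2 (Finset.mem_inter.1 hbQ).2 hab
      (hmem a haQ) (hmem b hbQ)
  exact hsub hwℓ

/-- **NINE COLLINEAR POINTS OF `W` ⇒ FAIR** (with at most `28` points of `W` off the line). -/
theorem basis_pair_fair_of_nine_collinear (hG : G ∈ flatsQ M (5 + 1)) (hd : (gr M \ G).card = 2)
    (hk : kColoops M G = 1) (hs : ∀ e ∈ gr M, ∀ f ∈ gr M, e ≠ f → rkN M {e, f} = 2)
    (hl : ∀ e ∈ gr M, M.Indep {e}) (hnf : fatClosures M 5 G 2 = ∅) {B : Finset α}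
    (hB : B ∈ thinMembers M 5 G) (hnP : ¬ bigP M G B) {z : α} (hz : z ∈ G \ clF M B)
    (hl0 : loss M 5 G B z ≠ 0) {x y : α} (hx : x ∈ G \ coloops M G) (hy : y ∈ G \ coloops M G) (hxy : x ≠ y)
    (hd9 : 9 ≤ ((G \ insert z B) ∩ clF M {x, y}).card)
    (hk28 : ((G \ insert z B) \ clF M {x, y}).card ≤ 28) :
    loss M 5 G B z ≤ rhoL M 5 G B z * lossIncomeH M 5 G (bigP M G) (dshGT2 M 5 G) B z := by
  have hind : M.Indep ((insert z B \ coloops M G : Finset α) : Set α) :=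
    (indep_insert_of_basis_pair hG hd hk hB hnP hz).subset (by exact_mod_cast (Finset.sdiff_subset))
  have hq2 := card_inter_clF_pair_le_two_of_indep hind (a := x) (b := y)
  rcases Nat.lt_or_ge ((G \ insert z B) \ clF M {x, y}).card 3 with hlt | hge
  · rcases Nat.lt_or_ge ((G \ insert z B) \ clF M {x, y}).card 2 with hlt1 | hge2
    · -- at most one point off the line: `rk W ≤ 3`, impossible
      exfalso
      have h4 := four_le_rkN_sdiff_insert hd hB z
      have hsplit : G \ insert z B ⊆ ((G \ insert z B) ∩ clF M {x, y}) ∪ ((G \ insert z B) \ clF M {x, y}) := by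
        intro e he
        by_cases hel : e ∈ clF M {x, y}
        · exact Finset.mem_union_left _ (Finset.mem_inter.2 ⟨he, hel⟩)
        · exact Finset.mem_union_right _ (Finset.mem_sdiff.2 ⟨he, hel⟩)
      have h1 := rkN_mono (M := M) hsplit
      have h2 := rkN_union_le_add (M := M) ((G \ insert z B) ∩ clF M {x, y}) ((G \ insert z B) \ clF M {x, y})
      have h3 : rkN M ((G \ insert z B) ∩ clF M {x, y}) ≤ 2 := by
        refine le_trans (rkN_le_of_subset_clF' Finset.inter_subset_right) ?_
        exact le_trans (rkN_le_card _) Finset.card_le_two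
      have h5 := rkN_le_card (M := M) ((G \ insert z B) \ clF M {x, y})
      omega
    · have hk2 : ((G \ insert z B) \ clF M {x, y}).card = 2 := by omega
      rcases Nat.lt_or_ge ((insert z B \ coloops M G) ∩ clF M {x, y}).card 2 with hq1 | hq2'
      · exact basis_pair_fair_of_line_two_off hG hd hk hs hl hnf hB hnP hz hl0 (by omega) hd9 hk2
      · exact basis_pair_fair_of_line_two_off_basis hG hd hk hs hl hnf hB hnP hz hl0 (by omega) hk2
  · apply basis_pair_fair_of_line_hit hG hd hk hs hl hnf hB hnP hz hl0 hx hy hxy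
    exact le_trans (one_le_lineHitIncome_nine hq2 hge hk28) (lineHitIncome_mono_left _ _ hd9)

/-- **The small line cells**: `(|W ∩ ℓ|, |W ∖ ℓ|) = (6, 6), (7, 6), (7, 5), (8, 6), (8, 5), (8, 4)` ⇒ fair. -/
theorem basis_pair_fair_of_line_cells (hG : G ∈ flatsQ M (5 + 1)) (hd : (gr M \ G).card = 2)
    (hk : kColoops M G = 1) (hs : ∀ e ∈ gr M, ∀ f ∈ gr M, e ≠ f → rkN M {e, f} = 2)
    (hl : ∀ e ∈ gr M, M.Indep {e}) (hnf : fatClosures M 5 G 2 = ∅) {B : Finset α}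
    (hB : B ∈ thinMembers M 5 G) (hnP : ¬ bigP M G B) {z : α} (hz : z ∈ G \ clF M B)
    (hl0 : loss M 5 G B z ≠ 0) {x y : α} (hx : x ∈ G \ coloops M G) (hy : y ∈ G \ coloops M G) (hxy : x ≠ y)
    (hdk : (((G \ insert z B) ∩ clF M {x, y}).card = 6 ∧ ((G \ insert z B) \ clF M {x, y}).card = 6) ∨
      (((G \ insert z B) ∩ clF M {x, y}).card = 7 ∧ ((G \ insert z B) \ clF M {x, y}).card = 6) ∨
      (((G \ insert z B) ∩ clF M {x, y}).card = 7 ∧ ((G \ insert z B) \ clF M {x, y}).card = 5) ∨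
      (((G \ insert z B) ∩ clF M {x, y}).card = 8 ∧ ((G \ insert z B) \ clF M {x, y}).card = 6) ∨
      (((G \ insert z B) ∩ clF M {x, y}).card = 8 ∧ ((G \ insert z B) \ clF M {x, y}).card = 5) ∨
      (((G \ insert z B) ∩ clF M {x, y}).card = 8 ∧ ((G \ insert z B) \ clF M {x, y}).card = 4)) :
    loss M 5 G B z ≤ rhoL M 5 G B z * lossIncomeH M 5 G (bigP M G) (dshGT2 M 5 G) B z := by
  have hind : M.Indep ((insert z B \ coloops M G : Finset α) : Set α) :=
    (indep_insert_of_basis_pair hG hd hk hB hnP hz).subset (by exact_mod_cast (Finset.sdiff_subset))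
  have hq2 := card_inter_clF_pair_le_two_of_indep hind (a := x) (b := y)
  exact basis_pair_fair_of_line_hit hG hd hk hs hl hnf hB hnP hz hl0 hx hy hxy
    (one_le_lineHitIncome_small hq2 hdk)

end PercRepro.Shadow
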